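import Mathlib.RingTheory.GradedAlgebra.Basic
import Mathlib.RingTheory.Adjoin.Tower
import Mathlib.RingTheory.IntegralClosure.IntegrallyClosed
import Mathlib.RingTheory.IntegralClosure.IsIntegralClosure.Basic
import Mathlib.RingTheory.Localization.FractionRing
import Mathlib.RingTheory.Spectrum.Prime.Topology
import Mathlib.GroupTheory.Torsion
import Mathlib.RingTheory.LocalProperties.IntegrallyClosed
import Literature.AlgebraicGeometry.Resolution.TameQuotientSingularitiesResolution
import Literature.AlgebraicGeometry.Resolution.SmoothOverNormal
import Literature.AlgebraicGeometry.Resolution.FiniteQuotientSingularityPresentation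
import Literature.RingTheory.Flat.NormalityDescends
import Literature.RingTheory.IntegralClosure.IntegrallyClosedLocal
import Literature.RingTheory.GradedAlgebra.LocalizationDegreeZero
import Mathlib.RingTheory.LocalProperties.Reduced
import Mathlib.RingTheory.Localization.LocalizationLocalization
import Mathlib.RingTheory.DedekindDomain.Basic
import Mathlib.AlgebraicGeometry.Noetherian
import Literature.AlgebraicGeometry.Resolution.CanonicalResolutionProofs
import Literature.AlgebraicGeometry.Resolution.RegularLocusDense
import HarnessLib

/-!
# Towards Bergh–Rydh 2019, Thm 5 (diagonalizable case): the quotient charts `U → U/D(A)`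

Topic: `Literature/AlgebraicGeometry/Resolution`. Sibling proof file of the named fact
`BerghRydh2019_diagonalizableQuotientResolution` (`TameQuotientSingularitiesResolution.lean`),
holding the PROVED steps of its discharge (D-0026: theorems only, no new named facts).

## Status of the discharge

The printed proof (arXiv:1905.00872, Thm 5, p. 4) is two lines: Satriano's canonical stack
`X_can → X` (a smooth tame Artin stack with coarse space `X`, an isomorphism over an open
`U ⊆ X` with `codim (X ∖ U) ≥ 2`), followed by destackification (loc. cit. Thm 2) of `X_can`. Both
inputs are theorems about tame algebraic stacks (root stacks, rigidifications, stacky blow-ups),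
none of which exists in Mathlib; the fact is therefore of size XL and its `_holds` theorem is not in
this file yet. What IS here is the scheme-free commutative algebra of the hypothesis — the
structure of one chart `U = Spec S → U/G = Spec S₀`, `G = D(A) = Spec k[A]` a finite
diagonalizable group, i.e. `S = ⨁_{a ∈ A} S_a` graded by the finite abelian group `A`
(Mathlib `GradedAlgebra 𝒮`) and `S₀ = 𝒮 0` its ring of invariants — which every approach to the
theorem (canonical stack, Luna slices, toroidal charts) consumes first:

* `pow_mem_gradeZero`, `isIntegral_of_mem`, `algebra_isIntegral`: a homogeneous element of
  torsion degree `a` has `s ^ (addOrderOf a) ∈ S₀`, so `S` is INTEGRAL over `S₀` as soon as the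
  grading group is torsion (in particular finite) — the quotient map `U → U/G` is integral;
* `comap_algebraMap_gradeZero_surjective`, `specMap_gradeZero_surjective`: `U → U/G` is
  surjective (lying over);
* `module_finite_gradeZero`, `finiteType_gradeZero`, `isNoetherianRing_gradeZero`: if `S` is of
  finite type over a Noetherian ring `R` (graded by `R`-submodules) then `S` is a finite
  `S₀`-module and `S₀` is of finite type over `R` (Artin–Tate) — `U/G` is of finite type and
  `U → U/G` is finite (Hilbert–Noether finiteness of invariants, diagonalizable case);
* `isDomain_gradeZero`, `isIntegrallyClosed_gradeZero`: if `S` is a normal domain then so is `S₀`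
  — `U/G` is normal when `U` is (the input of Satriano's codimension-2 condition);
* `isIntegrallyClosed_stalk_of_flat`: **normality descends along a flat morphism at a point**
  (the stalk map is a flat local homomorphism, hence faithfully flat; Stacks 033G,
  `Literature.RingTheory.Flat.isIntegrallyClosed_of_faithfullyFlat`) — in particular along the
  ÉTALE charts of the fact;
* `isIntegrallyClosed_stalk_of_chart`: under the hypothesis of
  `BerghRydh2019_diagonalizableQuotientResolution`, the local ring of `X` at every point covered by
  a chart `Spec S₀ → X` whose `S` is a DOMAIN is an integrally closed domain — `X` is normal there
  (first sentence of the printed proof: Satriano's canonical stack needs `X` normal, so that the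
  regular locus has complement of codimension `≥ 2`). The charts of the fact may have `S` smooth
  but disconnected (the finite group scheme `D(A)` permuting the components); these are handled
  by localizing the grading instead:
* `mem_nonZeroDivisors_of_gradeZero`, `isIntegrallyClosed_gradeZero_of_isReduced` (reduced `S`,
  torsion grading), `isReduced_of_smooth`, `isIntegrallyClosed_localization_of_smooth` (smooth ⇒
  regular ⇒ normal local rings: `isRegularLocalRing_localization_of_smooth_of_field`,
  `isIntegrallyClosed_of_isRegularLocalRing`),
  `isIntegrallyClosed_of_isLocalization_atPrime_gradeZero`, `isIntegrallyClosed_stalk_Spec_gradeZero`,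
  `isIntegrallyClosed_stalk_of_flat'`, `isIntegrallyClosed_stalk_of_chart'` and finally
  `isIntegrallyClosed_stalk_of_hypothesis`: **under the hypothesis of the fact (verbatim), every
  local ring of `X` is an integrally closed domain — `X` is normal;**
* `regularLocus_of_hypothesis`: hence `Reg X` is open, dense and contains all points of
  codimension `≤ 1` (normal ⇒ (R₁)) — the `U` with `codim (X ∖ U) ≥ 2` over which Satriano's
  canonical stack is an isomorphism. Everything the printed proof says about `X` before the word
  "stack" is now proved; what remains (canonical stack, destackification) has no counterpart in
  Mathlib.

The graded statements are for an arbitrary grading `𝒮 : A → Submodule R S` of a commutative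
`R`-algebra by an additive commutative group `A` (torsion / finite where needed); only Mathlib and
the tree's regular-local-ring library are used.

References: D. Bergh, D. Rydh, arXiv:1905.00872, Thm 5 and the definition preceding it (p. 4);
for the invariant theory of diagonalizable groups SGA 3, Exp. VIII §§4–5 and Mumford, *GIT*,
Thm 1.1 / *Abelian Varieties* §7 (finite group schemes). [cite: BerghRydh2019, Thm 5 (p. 4)]
-/

noncomputable section

open CategoryTheory DirectSum AlgebraicGeometry

namespace Literature.AlgebraicGeometry.Resolution

namespace DiagonalizableQuotient

universe u v w

section Graded

variable {R : Type u} {S : Type v} {A : Type w} [CommRing R] [CommRing S] [Algebra R S]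
  [DecidableEq A] [AddCommGroup A] (𝒮 : A → Submodule R S) [GradedAlgebra 𝒮]

/-! ## The tower `R → S₀ → S` -/

/-- `R → S₀ → S` is a scalar tower (both maps are the inclusions); a theorem rather than a
global instance (use `haveI := isScalarTower_gradeZero 𝒮`). [folklore] -/
theorem isScalarTower_gradeZero : IsScalarTower R (𝒮 0) S :=
  IsScalarTower.of_algebraMap_eq fun _ => rfl

/-- `S₀ → S` is injective. [folklore] -/
theorem algebraMap_gradeZero_injective : Function.Injective (algebraMap (𝒮 0) S) :=
  Subtype.val_injective

/-- `S₀` acts faithfully on `S` (the algebra map is injective). [folklore] -/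
theorem faithfulSMul_gradeZero : FaithfulSMul (𝒮 0) S :=
  (faithfulSMul_iff_algebraMap_injective _ _).mpr (algebraMap_gradeZero_injective 𝒮)

/-- A subring of a domain: `S₀` is a domain if `S` is. [folklore] -/
theorem isDomain_gradeZero [IsDomain S] : IsDomain (𝒮 0) :=
  Function.Injective.isDomain (algebraMap (𝒮 0) S) (algebraMap_gradeZero_injective 𝒮)

/-! ## Integrality of `S` over `S₀` (torsion grading) -/

/-- If `s` is homogeneous of degree `a` and `n • a = 0` then `s ^ n ∈ S₀`. [folklore] -/
theorem pow_mem_gradeZero {a : A} {s : S} (hs : s ∈ 𝒮 a) {n : ℕ} (hn : n • a = 0) :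
    s ^ n ∈ 𝒮 0 :=
  hn ▸ SetLike.pow_mem_graded n hs

/-- `s ^ (addOrderOf a) ∈ S₀` for `s ∈ S_a`. [folklore] -/
theorem pow_addOrderOf_mem_gradeZero {a : A} {s : S} (hs : s ∈ 𝒮 a) :
    s ^ addOrderOf a ∈ 𝒮 0 :=
  pow_mem_gradeZero 𝒮 hs (addOrderOf_nsmul_eq_zero a)

/-- A homogeneous element of torsion degree is integral over `S₀` (a root of
`X ^ (addOrderOf a) - s ^ (addOrderOf a)`). [folklore] -/
theorem isIntegral_of_mem {a : A} (ha : IsOfFinAddOrder a) {s : S} (hs : s ∈ 𝒮 a) :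
    IsIntegral (𝒮 0) s := by
  refine IsIntegral.of_pow ha.addOrderOf_pos ?_
  exact isIntegral_algebraMap (R := 𝒮 0) (A := S)
    (x := ⟨s ^ addOrderOf a, pow_addOrderOf_mem_gradeZero 𝒮 hs⟩)

/-- **`S` is integral over `S₀` when the grading group is torsion** (every element is a finite
sum of homogeneous elements, each integral): the quotient map `Spec S → Spec S₀ = (Spec S)/D(A)`
by a finite diagonalizable group is integral. [folklore] -/
theorem algebra_isIntegral (hA : AddMonoid.IsTorsion A) : Algebra.IsIntegral (𝒮 0) S := by
  classical
  refine ⟨fun s => ?_⟩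
  rw [← DirectSum.sum_support_decompose 𝒮 s]
  exact IsIntegral.sum _ fun a _ => isIntegral_of_mem 𝒮 (hA a) (SetLike.coe_mem _)

/-- Finite grading group: `S` is integral over `S₀`. [folklore] -/
theorem algebra_isIntegral_of_finite [Finite A] : Algebra.IsIntegral (𝒮 0) S :=
  algebra_isIntegral 𝒮 fun a => isOfFinAddOrder_of_finite a

/-- **Lying over for the quotient map**: `Spec S → Spec S₀` is surjective (torsion grading).
[folklore] -/
theorem comap_algebraMap_gradeZero_surjective (hA : AddMonoid.IsTorsion A) :
    Function.Surjective (PrimeSpectrum.comap (algebraMap (𝒮 0) S)) := by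
  haveI := algebra_isIntegral 𝒮 hA
  haveI := faithfulSMul_gradeZero 𝒮
  exact Algebra.IsIntegral.comap_surjective _ _

/-- Scheme form: the quotient morphism `U = Spec S → Spec S₀ = U/D(A)` is surjective (torsion
grading). [folklore] -/
theorem specMap_gradeZero_surjective (hA : AddMonoid.IsTorsion A) :
    Function.Surjective (Spec.map (CommRingCat.ofHom (algebraMap (𝒮 0) S))) := by
  intro x
  obtain ⟨y, hy⟩ := comap_algebraMap_gradeZero_surjective 𝒮 hA x
  exact ⟨y, by rw [Spec.map_apply]; exact hy⟩

/-! ## Finiteness (Hilbert–Noether for diagonalizable groups) -/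

/-- **`S` is a finite `S₀`-module** if `S` is of finite type over `R` and the grading group is
torsion (finite type + integral ⇒ finite). [folklore] -/
theorem module_finite_gradeZero (hA : AddMonoid.IsTorsion A) [Algebra.FiniteType R S] :
    Module.Finite (𝒮 0) S := by
  haveI := algebra_isIntegral 𝒮 hA
  haveI := isScalarTower_gradeZero 𝒮
  haveI : Algebra.FiniteType (𝒮 0) S :=
    Algebra.FiniteType.of_restrictScalars_finiteType (R := R) (S := 𝒮 0) (A := S)
  exact Algebra.IsIntegral.finite

/-- **The ring of invariants `S₀` is of finite type** over a Noetherian `R` if `S` is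
(Artin–Tate applied to `R → S₀ → S`, `S` finite over `S₀`). [folklore] -/
theorem finiteType_gradeZero [IsNoetherianRing R] (hA : AddMonoid.IsTorsion A)
    [h : Algebra.FiniteType R S] : Algebra.FiniteType R (𝒮 0) := by
  haveI := module_finite_gradeZero 𝒮 hA
  haveI := isScalarTower_gradeZero 𝒮
  exact ⟨fg_of_fg_of_fg (A := R) (B := 𝒮 0) (C := S) h.out Module.Finite.fg_top
    (algebraMap_gradeZero_injective 𝒮)⟩

/-- `S₀` is Noetherian if `S` is of finite type over a Noetherian `R` (torsion grading).
[folklore] -/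
theorem isNoetherianRing_gradeZero [IsNoetherianRing R] (hA : AddMonoid.IsTorsion A)
    [Algebra.FiniteType R S] : IsNoetherianRing (𝒮 0) :=
  haveI := finiteType_gradeZero 𝒮 hA
  Algebra.FiniteType.isNoetherianRing R (𝒮 0)

/-! ## Normality of the ring of invariants -/

/-- An element of `S` all of whose components of non-zero degree vanish lies in `S₀`. [folklore] -/
theorem mem_gradeZero_of_decompose_eq_zero {s : S} (h : ∀ a ≠ 0, (decompose 𝒮 s a : S) = 0) :
    s ∈ 𝒮 0 := by
  classical
  have hs : s = (decompose 𝒮 s 0 : S) := by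
    conv_lhs => rw [← DirectSum.sum_support_decompose 𝒮 s]
    rw [Finset.sum_eq_single (0 : A) (fun a _ ha => h a ha) (fun h0 => by simpa using h0)]
  rw [hs]
  exact SetLike.coe_mem _

/-- **The ring of invariants of a normal domain is a normal domain**: if `S` is an integrally
closed domain then so is `S₀` (any grading group). If `x = p/q` (`p, q ∈ S₀`) is integral over
`S₀`, it is integral over `S`, so `x = s ∈ S`; from `s q = p` and `q ∈ S₀ ∖ 0` every component
`s_a`, `a ≠ 0`, vanishes, so `s ∈ S₀`. [folklore] -/
theorem isIntegrallyClosed_gradeZero [IsDomain S] [IsIntegrallyClosed S] :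
    IsIntegrallyClosed (𝒮 0) := by
  haveI : IsDomain (𝒮 0) := isDomain_gradeZero 𝒮
  let K := FractionRing S
  have hg : Function.Injective (algebraMap (𝒮 0) K) := by
    rw [IsScalarTower.algebraMap_eq (𝒮 0) S K]
    exact (IsFractionRing.injective S K).comp (algebraMap_gradeZero_injective 𝒮)
  let f : FractionRing (𝒮 0) →ₐ[𝒮 0] K :=
    IsFractionRing.liftAlgHom (g := Algebra.ofId (𝒮 0) K) hg
  rw [isIntegrallyClosed_iff (FractionRing (𝒮 0))]
  intro x hx
  obtain ⟨⟨p, q⟩, rfl⟩ := IsLocalization.mk'_surjective (nonZeroDivisors (𝒮 0)) x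
  -- `f x` is integral over `S`, hence comes from some `s : S`
  obtain ⟨s, hs⟩ := (IsIntegrallyClosed.isIntegral_iff (R := S) (K := K)).mp (hx.map f).tower_top
  -- `s * q = p` in `S`
  have hsq : s * ((q : 𝒮 0) : S) = (p : S) := by
    apply IsFractionRing.injective S K
    have h1 := congrArg f (IsLocalization.mk'_spec (FractionRing (𝒮 0)) p q)
    rw [map_mul, AlgHom.commutes, AlgHom.commutes, ← hs,
      IsScalarTower.algebraMap_apply (𝒮 0) S K (q : 𝒮 0),
      IsScalarTower.algebraMap_apply (𝒮 0) S K p, ← map_mul] at h1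
    exact h1
  -- the components of `s` of non-zero degree vanish
  have hq0 : ((q : 𝒮 0) : S) ≠ 0 :=
    (map_ne_zero_iff _ (algebraMap_gradeZero_injective 𝒮)).mpr (nonZeroDivisors.ne_zero q.2)
  have h0 : ∀ a ≠ 0, (decompose 𝒮 s a : S) = 0 := by
    intro a ha
    have h2 := congrArg (fun t => (decompose 𝒮 t a : S)) hsq
    simp only at h2
    rw [coe_decompose_mul_of_right_mem_zero 𝒮 (SetLike.coe_mem _),
      decompose_of_mem_ne 𝒮 p.2 (Ne.symm ha)] at h2
    exact (mul_eq_zero.mp h2).resolve_right hq0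
  refine ⟨⟨s, mem_gradeZero_of_decompose_eq_zero 𝒮 h0⟩, ?_⟩
  rw [IsLocalization.eq_mk'_iff_mul_eq, ← map_mul]
  congr 1
  exact Subtype.ext hsq

end Graded

/-! ## Normality descends along flat (in particular étale) morphisms -/

/-- **Normality descends along a flat morphism, pointwise**: if `φ : Y ⟶ X` is flat and the local
ring of `Y` at `y` is an integrally closed domain, then so is the local ring of `X` at `φ y` — the
stalk map `𝒪_{X,φ y} → 𝒪_{Y,y}` is a flat local homomorphism of local rings, hence faithfully
flat, and normality descends (Stacks 033G). Étale morphisms are flat (Mathlib instances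
`Etale ⇒ Smooth ⇒ Flat`). [cite: StacksProject, Tag 033G] -/
theorem isIntegrallyClosed_stalk_of_flat {Y X : Scheme.{u}} (φ : Y ⟶ X) [Flat φ] (y : Y)
    [IsDomain (Y.presheaf.stalk y)] [IsIntegrallyClosed (Y.presheaf.stalk y)] :
    IsIntegrallyClosed (X.presheaf.stalk (φ.base y)) ∧ IsDomain (X.presheaf.stalk (φ.base y)) := by
  have hf : (φ.stalkMap y).hom.Flat := Flat.stalkMap φ y
  algebraize [(φ.stalkMap y).hom]
  haveI : IsLocalHom (algebraMap (X.presheaf.stalk (φ.base y)) (Y.presheaf.stalk y)) :=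
    inferInstanceAs (IsLocalHom (φ.stalkMap y).hom)
  haveI : Module.FaithfullyFlat (X.presheaf.stalk (φ.base y)) (Y.presheaf.stalk y) :=
    Module.FaithfullyFlat.of_flat_of_isLocalHom
  exact ⟨Literature.RingTheory.Flat.isIntegrallyClosed_of_faithfullyFlat _ (Y.presheaf.stalk y),
    Literature.RingTheory.Flat.isDomain_of_faithfullyFlat _ (Y.presheaf.stalk y)⟩

/-! ## `X` is normal at the points covered by domain charts -/

/-- **Normality of `X` along a domain chart of `BerghRydh2019_diagonalizableQuotientResolution`**:
for a chart `φ : Spec S₀ ⟶ X`, étale, with `S` a smooth DOMAIN of finite type over the field `k`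
graded by the additive group `A` and `S₀ = 𝒮 0`, the local ring of `X` at every point `φ v` is an
integrally closed domain: `S` is normal (`isIntegrallyClosed_of_smooth_of_field`,
`SmoothOverNormal.lean`), so is its ring of invariants `S₀` (`isIntegrallyClosed_gradeZero`), so
are the stalks of `Spec S₀` (`Motives.isIntegrallyClosed_stalk_Spec`), and normality
descends along the étale `φ` (`isIntegrallyClosed_stalk_of_flat`). This is the first input of the
printed proof ("`X` admits a canonical stack … an isomorphism over an open `U ⊂ X` such that
`X ∖ U` has codimension `≥ 2`" needs `X` normal). [cite: BerghRydh2019, proof of Thm 5 (p. 4)] -/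
theorem isIntegrallyClosed_stalk_of_chart {k : Type u} [Field k] {A : Type w} [DecidableEq A]
    [AddCommGroup A] {S : Type u} [CommRing S] [IsDomain S] [Algebra k S] [Algebra.Smooth k S]
    (𝒮 : A → Submodule k S) [GradedAlgebra 𝒮] {X : Scheme.{u}}
    (φ : Spec (.of (𝒮 0)) ⟶ X) [Etale φ] (v : Spec (.of (𝒮 0))) :
    IsIntegrallyClosed (X.presheaf.stalk (φ.base v)) ∧ IsDomain (X.presheaf.stalk (φ.base v)) := by
  haveI : IsIntegrallyClosed S := isIntegrallyClosed_of_smooth_of_field k S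
  haveI : IsDomain (𝒮 0) := isDomain_gradeZero 𝒮
  haveI : IsIntegrallyClosed (𝒮 0) := isIntegrallyClosed_gradeZero 𝒮
  haveI := isDomain_stalk_spec (.of (𝒮 0)) v
  haveI := Motives.isIntegrallyClosed_stalk_Spec (.of (𝒮 0)) v
  exact isIntegrallyClosed_stalk_of_flat φ v

/-! ## The general charts: `S` smooth but possibly disconnected

The charts of the fact have `S` smooth over `k`, hence regular, reduced and with integrally closed
local rings, but possibly DISCONNECTED (the finite group scheme `D(A)` may permute the connected
components of `U = Spec S`), so that `S₀` need not be the ring of invariants of a domain. We prove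
that the local rings of `Spec S₀` are nevertheless integrally closed in their total rings of
fractions, by localizing the grading: for a prime `𝔮 ⊂ S₀`, `T⁻¹S` (`T = S₀ ∖ 𝔮`) is graded with
degree-zero part `(S₀)_𝔮` (`Literature.RingTheory.GradedAlgebra.isLocalization_locPiece_zero`),
it is reduced with integrally closed local rings, hence integrally closed in its total ring of
fractions (`Literature.RingTheory.IntegralClosure.isIntegrallyClosed_of_localization_maximal`),
and the degree-zero part of such a graded ring is again integrally closed
(`isIntegrallyClosed_gradeZero_of_isReduced`: a non-zero-divisor of `S₀` stays a non-zero-divisor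
of the reduced `S` when the grading group is torsion). Normality of `X` at `φ v` then descends
along the étale chart because the local rings of the INTEGRAL scheme `X` are domains
(`Literature.RingTheory.Flat.isIntegrallyClosed_of_faithfullyFlat_of_isDomain`). -/

section GeneralCharts

variable {R : Type u} {S : Type v} {A : Type w} [CommRing R] [CommRing S] [Algebra R S]
  [DecidableEq A] [AddCommGroup A] (𝒮 : A → Submodule R S) [GradedAlgebra 𝒮]

/-- **A non-zero-divisor of `S₀` is a non-zero-divisor of `S`** when `S` is reduced and the
grading group is torsion: if `t s = 0` then `t s_a = 0` for every component, so
`t s_aⁿ = 0` with `s_aⁿ ∈ S₀` (`n = ord a`), whence `s_aⁿ = 0` and `s_a = 0`. [folklore] -/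
theorem mem_nonZeroDivisors_of_gradeZero [IsReduced S] (hA : AddMonoid.IsTorsion A)
    {t : 𝒮 0} (ht : t ∈ nonZeroDivisors (𝒮 0)) : (t : S) ∈ nonZeroDivisors S := by
  classical
  rw [mem_nonZeroDivisors_iff_right]
  intro s hs
  rw [← DirectSum.sum_support_decompose 𝒮 s]
  refine Finset.sum_eq_zero fun a _ => ?_
  -- `s_a * t = 0`
  have hta : (decompose 𝒮 s a : S) * t = 0 := by
    have h := congrArg (fun x => (decompose 𝒮 x a : S)) hs
    simp only at h
    rw [coe_decompose_mul_of_right_mem_zero 𝒮 t.2, decompose_zero, DirectSum.zero_apply,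
      ZeroMemClass.coe_zero] at h
    exact h
  -- `s_a ^ n ∈ S₀` is killed by `t`, hence zero
  have hn : 0 < addOrderOf a := (hA a).addOrderOf_pos
  have hmem : (decompose 𝒮 s a : S) ^ addOrderOf a ∈ 𝒮 0 :=
    pow_addOrderOf_mem_gradeZero 𝒮 (SetLike.coe_mem _)
  have h0 : (⟨_, hmem⟩ : 𝒮 0) = 0 := by
    refine (mem_nonZeroDivisors_iff_right.mp ht) _ (Subtype.ext ?_)
    change (decompose 𝒮 s a : S) ^ addOrderOf a * (t : S) = 0
    rw [← Nat.sub_add_cancel hn, pow_succ, mul_assoc, hta, mul_zero]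
  have hnil : IsNilpotent (decompose 𝒮 s a : S) := ⟨addOrderOf a, congrArg Subtype.val h0⟩
  exact hnil.eq_zero

/-- **The degree-zero part of a reduced, integrally closed graded ring is integrally closed**
(torsion grading group; "integrally closed" in the sense of the total ring of fractions, Mathlib
`IsIntegrallyClosed`): if `x = p/q ∈ Frac S₀` is integral over `S₀` then, `q` being a
non-zero-divisor of `S` (`mem_nonZeroDivisors_of_gradeZero`), `x ↦ Frac S` is defined and
integral over `S`, so `x = s ∈ S` with `s q = p`; comparing components, `s_a q = 0` for `a ≠ 0`,
so `s ∈ S₀`. (For a domain `S` this is `isIntegrallyClosed_gradeZero`.) [folklore] -/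
theorem isIntegrallyClosed_gradeZero_of_isReduced [IsReduced S] [IsIntegrallyClosed S]
    (hA : AddMonoid.IsTorsion A) : IsIntegrallyClosed (𝒮 0) := by
  let K := FractionRing S
  have hu : ∀ t : nonZeroDivisors (𝒮 0), IsUnit (Algebra.ofId (𝒮 0) K t) := fun t => by
    rw [Algebra.ofId_apply, IsScalarTower.algebraMap_apply (𝒮 0) S K]
    exact IsLocalization.map_units K
      (⟨_, mem_nonZeroDivisors_of_gradeZero 𝒮 hA t.2⟩ : nonZeroDivisors S)
  let f : FractionRing (𝒮 0) →ₐ[𝒮 0] K :=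
    IsLocalization.liftAlgHom (M := nonZeroDivisors (𝒮 0)) (f := Algebra.ofId (𝒮 0) K) hu
  rw [isIntegrallyClosed_iff (FractionRing (𝒮 0))]
  intro x hx
  obtain ⟨⟨p, q⟩, rfl⟩ := IsLocalization.mk'_surjective (nonZeroDivisors (𝒮 0)) x
  obtain ⟨s, hs⟩ := (IsIntegrallyClosed.isIntegral_iff (R := S) (K := K)).mp (hx.map f).tower_top
  -- `s * q = p` in `S`
  have hsq : s * ((q : 𝒮 0) : S) = (p : S) := by
    apply IsFractionRing.injective S K
    have h1 := congrArg f (IsLocalization.mk'_spec (FractionRing (𝒮 0)) p q)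
    rw [map_mul, AlgHom.commutes, AlgHom.commutes, ← hs,
      IsScalarTower.algebraMap_apply (𝒮 0) S K (q : 𝒮 0),
      IsScalarTower.algebraMap_apply (𝒮 0) S K p, ← map_mul] at h1
    exact h1
  have hq0 : ((q : 𝒮 0) : S) ∈ nonZeroDivisors S := mem_nonZeroDivisors_of_gradeZero 𝒮 hA q.2
  have h0 : ∀ a ≠ 0, (decompose 𝒮 s a : S) = 0 := by
    intro a ha
    have h2 := congrArg (fun t => (decompose 𝒮 t a : S)) hsq
    simp only at h2
    rw [coe_decompose_mul_of_right_mem_zero 𝒮 (SetLike.coe_mem _),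
      decompose_of_mem_ne 𝒮 p.2 (Ne.symm ha)] at h2
    exact (mem_nonZeroDivisors_iff_right.mp hq0) _ h2
  refine ⟨⟨s, mem_gradeZero_of_decompose_eq_zero 𝒮 h0⟩, ?_⟩
  rw [IsLocalization.eq_mk'_iff_mul_eq, ← map_mul]
  congr 1
  exact Subtype.ext hsq

end GeneralCharts

/-! ### Smooth algebras over a field: reduced, with integrally closed localizations -/

section Smooth

/-- **A smooth algebra over a field is reduced** (its local rings are regular,
`isRegularLocalRing_localization_of_smooth_of_field`, hence domains). [folklore] -/
theorem isReduced_of_smooth (k S : Type u) [Field k] [CommRing S] [Algebra k S]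
    [Algebra.Smooth k S] : IsReduced S := by
  refine isReduced_ofLocalizationMaximal S fun p _ => ?_
  haveI := isRegularLocalRing_localization_of_smooth_of_field k S p
  haveI := isDomain_of_isRegularLocalRing (Localization.AtPrime p)
  infer_instance

/-- **Every localization of a smooth algebra over a field is integrally closed** in its total
ring of fractions: its local rings are local rings of `S`, regular
(`isRegularLocalRing_localization_of_smooth_of_field`) hence normal
(`isIntegrallyClosed_of_isRegularLocalRing`, Matsumura 19.4), and integral closedness is checked
at the maximal ideals (`Literature.RingTheory.IntegralClosure.isIntegrallyClosed_of_localization_maximal`).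
[cite: Matsumura1987, Thm. 19.4] -/
theorem isIntegrallyClosed_localization_of_smooth (k S : Type u) [Field k] [CommRing S]
    [Algebra k S] [Algebra.Smooth k S] (N : Submonoid S) :
    IsIntegrallyClosed (Localization N) := by
  refine Literature.RingTheory.IntegralClosure.isIntegrallyClosed_of_localization_maximal
    fun p hp => ?_
  let P : Ideal S := p.comap (algebraMap S (Localization N))
  haveI := isRegularLocalRing_localization_of_smooth_of_field k S P
  haveI := isIntegrallyClosed_of_isRegularLocalRing (Localization.AtPrime P)
  exact IsIntegrallyClosed.of_equiv
    (IsLocalization.localizationLocalizationAtPrimeIsoLocalization N p).toRingEquiv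

end Smooth

/-! ### The local rings of `Spec S₀` are integrally closed -/

section LocalRings

variable {k S : Type u} [Field k] [CommRing S] [Algebra k S] [Algebra.Smooth k S]
  {A : Type w} [DecidableEq A] [AddCommGroup A] (𝒮 : A → Submodule k S) [GradedAlgebra 𝒮]

/-- **The local rings of the quotient chart `Spec S₀` are integrally closed** (in their total
rings of fractions), for `S` smooth over a field — possibly disconnected — graded by a torsion
group: `(S₀)_𝔮` is the degree-zero part of the graded, reduced, integrally closed ring `T⁻¹S`,
`T = S₀ ∖ 𝔮`. [folklore] -/
theorem isIntegrallyClosed_of_isLocalization_atPrime_gradeZero (hA : AddMonoid.IsTorsion A)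
    (𝔮 : Ideal (𝒮 0)) [𝔮.IsPrime] (Rq : Type v) [CommRing Rq] [Algebra (𝒮 0) Rq]
    [IsLocalization.AtPrime Rq 𝔮] : IsIntegrallyClosed Rq := by
  classical
  -- the localization `L = T⁻¹S`, `T = image of S₀ ∖ 𝔮`, and its grading
  let T : Submonoid S := 𝔮.primeCompl.map (algebraMap (𝒮 0) S)
  have hT : ∀ t ∈ T, t ∈ 𝒮 0 := by
    rintro _ ⟨r, -, rfl⟩
    exact r.2
  let L := Localization T
  let ℒ := Literature.RingTheory.GradedAlgebra.locPiece 𝒮 T hT L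
  letI : GradedAlgebra ℒ :=
    (Literature.RingTheory.GradedAlgebra.nonempty_gradedAlgebra_locPiece 𝒮 T hT L).some
  -- `L` is reduced and integrally closed, so `ℒ 0` is integrally closed
  haveI : IsReduced S := isReduced_of_smooth k S
  haveI : IsIntegrallyClosed L := isIntegrallyClosed_localization_of_smooth k S T
  haveI : IsIntegrallyClosed (ℒ 0) := isIntegrallyClosed_gradeZero_of_isReduced ℒ hA
  -- `ℒ 0` is the localization of `S₀` at `𝔮`
  letI := Literature.RingTheory.GradedAlgebra.locPieceZeroAlgebra 𝒮 T hT L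
  have hloc := Literature.RingTheory.GradedAlgebra.isLocalization_locPiece_zero 𝒮 T hT L
  rw [Submonoid.comap_map_eq_of_injective (algebraMap_gradeZero_injective 𝒮)] at hloc
  haveI : IsLocalization.AtPrime (ℒ 0) 𝔮 := hloc
  exact IsIntegrallyClosed.of_equiv (R := ℒ 0)
    (IsLocalization.algEquiv 𝔮.primeCompl (ℒ 0) Rq).toRingEquiv

/-- In particular the localizations `(S₀)_𝔮` are integrally closed. [folklore] -/
theorem isIntegrallyClosed_localization_atPrime_gradeZero (hA : AddMonoid.IsTorsion A)
    (𝔮 : Ideal (𝒮 0)) [𝔮.IsPrime] : IsIntegrallyClosed (Localization.AtPrime 𝔮) :=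
  isIntegrallyClosed_of_isLocalization_atPrime_gradeZero 𝒮 hA 𝔮 _

/-- The stalks of the quotient chart `Spec S₀` are integrally closed (same hypotheses).
[folklore] -/
theorem isIntegrallyClosed_stalk_Spec_gradeZero (hA : AddMonoid.IsTorsion A)
    (v : Spec (.of (𝒮 0))) : IsIntegrallyClosed ((Spec (.of (𝒮 0))).presheaf.stalk v) := by
  letI : Algebra (𝒮 0) ((Spec (.of (𝒮 0))).presheaf.stalk v) :=
    inferInstanceAs (Algebra (𝒮 0) ((Spec.structureSheaf (𝒮 0)).presheaf.stalk v))
  haveI : IsLocalization.AtPrime ((Spec (.of (𝒮 0))).presheaf.stalk v) v.asIdeal :=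
    StructureSheaf.IsLocalization.to_stalk (𝒮 0) v
  exact isIntegrallyClosed_of_isLocalization_atPrime_gradeZero 𝒮 hA v.asIdeal _

end LocalRings

/-! ### Normality of `X` along all charts -/

/-- **Normality descends along a flat morphism, pointwise, onto integral stalks**: if
`φ : Y ⟶ X` is flat, the local ring of `X` at `φ y` is a domain (e.g. `X` integral) and the local
ring of `Y` at `y` is integrally closed in its total ring of fractions, then the local ring of `X`
at `φ y` is integrally closed. [cite: StacksProject, Tag 033G] -/
theorem isIntegrallyClosed_stalk_of_flat' {Y X : Scheme.{u}} (φ : Y ⟶ X) [Flat φ] (y : Y)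
    [IsDomain (X.presheaf.stalk (φ.base y))] [IsIntegrallyClosed (Y.presheaf.stalk y)] :
    IsIntegrallyClosed (X.presheaf.stalk (φ.base y)) := by
  have hf : (φ.stalkMap y).hom.Flat := Flat.stalkMap φ y
  algebraize [(φ.stalkMap y).hom]
  haveI : IsLocalHom (algebraMap (X.presheaf.stalk (φ.base y)) (Y.presheaf.stalk y)) :=
    inferInstanceAs (IsLocalHom (φ.stalkMap y).hom)
  haveI : Module.FaithfullyFlat (X.presheaf.stalk (φ.base y)) (Y.presheaf.stalk y) :=
    Module.FaithfullyFlat.of_flat_of_isLocalHom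
  exact Literature.RingTheory.Flat.isIntegrallyClosed_of_faithfullyFlat_of_isDomain _
    (Y.presheaf.stalk y)

/-- **`X` is normal along every chart of `BerghRydh2019_diagonalizableQuotientResolution`**:
for an étale chart `φ : Spec S₀ ⟶ X` with `S` smooth of finite type over the field `k` (possibly
disconnected) graded by the FINITE abelian group `A`, and `X` integral, the local ring of `X` at
every `φ v` is an integrally closed domain. [cite: BerghRydh2019, proof of Thm 5 (p. 4)] -/
theorem isIntegrallyClosed_stalk_of_chart' {k : Type u} [Field k] {A : Type w} [DecidableEq A]
    [AddCommGroup A] [Finite A] {S : Type u} [CommRing S] [Algebra k S] [Algebra.Smooth k S]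
    (𝒮 : A → Submodule k S) [GradedAlgebra 𝒮] {X : Scheme.{u}} [IsIntegral X]
    (φ : Spec (.of (𝒮 0)) ⟶ X) [Etale φ] (v : Spec (.of (𝒮 0))) :
    IsIntegrallyClosed (X.presheaf.stalk (φ.base v)) := by
  haveI := isIntegrallyClosed_stalk_Spec_gradeZero 𝒮 (fun a => isOfFinAddOrder_of_finite a) v
  exact isIntegrallyClosed_stalk_of_flat' φ v

/-- **Under the hypothesis of `BerghRydh2019_diagonalizableQuotientResolution`, `X` is normal**:
every local ring of `X` is an integrally closed domain (the domains because `X` is integral). This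
is the first input of the printed proof (Satriano's canonical stack is an isomorphism over an
open subset with complement of codimension `≥ 2` of the NORMAL variety `X`).
[cite: BerghRydh2019, proof of Thm 5 (p. 4)] -/
theorem isIntegrallyClosed_stalk_of_hypothesis (k : Type) [Field k] (X : Scheme.{0})
    (g : X ⟶ Spec (.of k)) [IsIntegral X]
    (H : ∀ x : X, ∃ (A : Type) (_ : AddCommGroup A) (_ : Finite A) (_ : DecidableEq A)
        (S : Type) (_ : CommRing S) (_ : Algebra k S) (𝒮 : A → Submodule k S)
        (_ : GradedAlgebra 𝒮), Algebra.FiniteType k S ∧ Algebra.Smooth k S ∧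
        ∃ φ : Spec (.of (𝒮 0)) ⟶ X, Etale φ ∧ x ∈ Set.range φ ∧
          φ ≫ g = Spec.map (CommRingCat.ofHom (algebraMap k (𝒮 0))))
    (x : X) : IsIntegrallyClosed (X.presheaf.stalk x) := by
  obtain ⟨A, _, _, _, S, _, _, 𝒮, _, -, _, φ, _, ⟨v, rfl⟩, -⟩ := H x
  exact isIntegrallyClosed_stalk_of_chart' 𝒮 φ v

/-! ### Satriano's input: `X` is regular in codimension one -/

/-- A normal Noetherian local domain of Krull dimension `≤ 1` is regular (a field or a discrete
valuation ring: Noetherian + dimension `≤ 1` + integrally closed = Dedekind, and Dedekind domains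
are regular rings) — "normal ⇒ (R₁)". [cite: Matsumura1987, Thm. 11.2] -/
theorem isRegularLocalRing_of_isIntegrallyClosed_of_dim_le_one (R : Type u) [CommRing R]
    [IsDomain R] [IsLocalRing R] [IsNoetherianRing R] [IsIntegrallyClosed R]
    (h : ringKrullDim R ≤ 1) : IsRegularLocalRing R := by
  haveI : Ring.KrullDimLE 1 R := Ring.krullDimLE_iff.mpr h
  haveI : Ring.DimensionLEOne R := ⟨fun hne hp => hp.isMaximal_of_ne_bot hne⟩
  haveI : IsDedekindRing R := (isDedekindRing_iff R (FractionRing R)).mpr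
    ⟨inferInstance, inferInstance,
      fun hx => (isIntegrallyClosed_iff (FractionRing R)).mp inferInstance hx⟩
  exact IsRegularLocalRing.of_isRegularRing_of_isLocalRing R

/-- **What the printed proof uses about `X` before the canonical stack enters** (Bergh–Rydh,
proof of Thm 5: "`X_can → X` is an isomorphism over an open subvariety `U ⊂ X` such that
`X ∖ U` has codimension `≥ 2`"; the `U` is the regular locus of the normal variety `X`): under the
hypothesis of `BerghRydh2019_diagonalizableQuotientResolution` (verbatim), the regular locus
`Reg X` is OPEN (finite type over a field, `isOpen_regularLocus_of_locallyOfFiniteType_field`),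
DENSE (`X` is reduced, `Scheme.dense_regularLocus`), and contains every point of codimension
`≤ 1`: a singular point has a local ring of dimension `≥ 2` (the local rings are normal,
`isIntegrallyClosed_stalk_of_hypothesis`, and normal ⇒ (R₁)).
[cite: BerghRydh2019, proof of Thm 5 (p. 4)] -/
theorem regularLocus_of_hypothesis (k : Type) [Field k] (X : Scheme.{0})
    (g : X ⟶ Spec (.of k)) [IsIntegral X] [LocallyOfFiniteType g]
    (H : ∀ x : X, ∃ (A : Type) (_ : AddCommGroup A) (_ : Finite A) (_ : DecidableEq A)
        (S : Type) (_ : CommRing S) (_ : Algebra k S) (𝒮 : A → Submodule k S)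
        (_ : GradedAlgebra 𝒮), Algebra.FiniteType k S ∧ Algebra.Smooth k S ∧
        ∃ φ : Spec (.of (𝒮 0)) ⟶ X, Etale φ ∧ x ∈ Set.range φ ∧
          φ ≫ g = Spec.map (CommRingCat.ofHom (algebraMap k (𝒮 0)))) :
    IsOpen (Scheme.regularLocus X) ∧ Dense (Scheme.regularLocus X) ∧
      ∀ x : X, x ∉ Scheme.regularLocus X → 1 < ringKrullDim (X.presheaf.stalk x) := by
  haveI : IsLocallyNoetherian X := LocallyOfFiniteType.isLocallyNoetherian g
  refine ⟨isOpen_regularLocus_of_locallyOfFiniteType_field g, Scheme.dense_regularLocus X,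
    fun x hx => ?_⟩
  by_contra hle
  rw [not_lt] at hle
  haveI := isIntegrallyClosed_stalk_of_hypothesis k X g H x
  exact hx (isRegularLocalRing_of_isIntegrallyClosed_of_dim_le_one _ hle)

end DiagonalizableQuotient

end Literature.AlgebraicGeometry.Resolution

end
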